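import Summits.QuantumFields.YangMills.Theorems.SwapVirialDeficitSectorLaplaceTipApexRef
import Summits.QuantumFields.YangMills.Theorems.SwapVirialDeficitSectorLaplaceTipShellDischarge
import Summits.QuantumFields.YangMills.Theorems.SwapVirialDeficitSectorLaplaceEndGaussPlugRate
import HarnessLib

/-!
# (hCore) FROM THREE REGION SOCKETS — PRELIMINARIES of the binder-facing consumer (F7 of w2 g61's aligned-rotation assembly, LEAD ruling (B8)): shell currency, tails, cover, adapters
# (cell ym-idea-1, skeleton ➎ v14, `stub_core_tip`; LEAD seat ym-line-sfw-p2 g100, free-hands support of ⟨stmt-QuantumFields-24197⟩ `SwapVirialDeficit.SwapGluedStiffness`)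

SOCKETS FIRST.  g49's FROZEN binder (STATUS 2026-09-01 01:31Z) is
`hubIntegral (hubAt δt 1) ε b ≤ Φ·L^cΦ·((2π/b)^α·∫_p Profile(δt,p)·𝔪(hubAt δs 1, ε, p)) + e^{CT·L^pT − b/(QT·L^pT)}` for `b ≥ K₁L^k₁`, good `ε`, `DR·L^dR ≤ δs ≤ δt`,
`Profile(δt,p) = (1+δt²)²/(1 + h(p)(1+δt²))`, `h(p) = p₁²/(1+p₁²) + p₂²/(1+p₂²)`.  This file proves it FROM three REGION SOCKETS of identical shape — one per region of a cover
`S₁ ∪ S₂ ∪ S₃ = GnoCoord L` (w2's ORIG ∕ PX ∕ PY, memo `w2-g61-memo-hCore-S3S4-aligned.md`; any cover works) — each bounding the fibre `lintegral` over its region by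
`ofReal(C·L^c·(2π/b)^α)·∫⁻_p ofReal(Profile(δt,p)·((1+p₁²)⁻¹(1+p₂²)⁻¹/√det A₀(gnoBase p))) + ofReal(e^{CT·L^pT − b/(QT·L^pT)})` for EVERY apex follower family `A₀`
(hypotheses `hA0s hA0yy hA0ray hA0amb` VERBATIM as in ✓`tipFibre_le`), `δs`-free.  The consumer supplies: the apex family (✓`exists_gnoFolHessian` at the hub `1`), the
shell currency (✓`apexRef_le_mbDensity_hubAt` with `δr := δs`, window `DR·L^dR ≤ δs`), the integrability of `Profile·𝔪(hubAt δs 1)` (✓`integrable_mbDensity_hubAt_of_window`),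
the Bochner ↔ `lintegral` conversions, and the merging of constants and tails (`3e^{x} ≤ e^{x+2}`).
* §1 bookkeeping (`apexConst_inv_le`: `((1+d)·20400L⁴)^{7/2} ≤ (19·20400)⁴·L³²`; `three_tails_le`; `pow_le_pow_of_le`);
* §2 `lintegral_profile_apexRef_le` — `∫⁻ ofReal(Profile·w₀/√det A₀) ≤ ofReal(e·(19·20400)⁴L³²·∫ Profile·𝔪(hubAt δs 1))`;
* §3 `socket_to_ofReal`, `lintegral_le_of_cover3` (ENNReal bookkeeping); §4 `tipRegions_cover` (w2's ORIG ∕ PX ∕ PY cover everything);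
* §5 raw-shape adapters `profile_ge_of_PX` (`(1+δt²)(1+a²)/a² ≤ 4·Profile` on the PX box), `profile_ge_of_ORIG` (`(1+δt²)² ≤ 3·Profile` on the ORIG disc),
  `baseWeight_ge_ninth_of_ORIG`.  The consumer theorem itself is ✓`…TipCoreRegions.lean` (next file).

HONEST LABEL: composition bookkeeping; the three sockets (w2 g61 F5/F6, g68 F2) are OPEN, hence (hCore), `stub_core_tip`, ⟨24197⟩ ∕ ⟨24194⟩ OPEN; own crux ⟨22884⟩
`LargeFieldMassRefinementTail` OPEN (blocked-on ⟨19935⟩); the Yang–Mills mass gap is NOT proved; no summit is proved by a line.  THEOREMS ONLY (0 `def`, 0 `sorry`, no instance,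
no notation), standard axioms.  `--supports stmt-QuantumFields-24197`.  References: [cite: Luscher1983, §2]; [folklore].
-/

set_option autoImplicit false
set_option synthInstance.maxSize 1024

noncomputable section

open MeasureTheory Quaternion Set Module
open scoped Quaternion BigOperators ENNReal InnerProductSpace
open Literature.MathematicalPhysics.QuantumLattice
open Literature.MathematicalPhysics.QuantumFieldTheory hiding SU2

namespace Summit.QuantumFields.YangMills.Theorems.SwapVirialDeficit.SectorLaplace

open Summit.QuantumFields.YangMills.Theorems.FemtoTransferGap
open Summit.QuantumFields.YangMills.Theorems.FemtoTransferGap.TT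
open Summit.QuantumFields.YangMills.Theorems.VirialFluxGap.RingDeficit
open Summit.QuantumFields.YangMills.Theorems.SwapVirialDeficit.SwapRing
open Summit.QuantumFields.YangMills.Theorems.SwapVirialDeficit.BlowUpRing

variable {L : ℕ} [NeZero L]

/-! ## §1 Bookkeeping -/

/-- The inverse apexRef constant is polynomial: `((1+d)·20400L⁴)^{7/2} ≤ (19·20400)⁴·L³²` (`d = dim V_F ≤ 18L⁴`, `x^{7/2} ≤ x⁴` for `x ≥ 1`). [folklore] -/
theorem apexConst_inv_le :
    ((1 + (finrank ℝ (GnoFol L) : ℝ)) * (20400 * (L : ℝ) ^ 4)) ^ (7 / 2 : ℝ) ≤ (19 * 20400) ^ 4 * (L : ℝ) ^ 32 := by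
  obtain ⟨hL1, -, hc6, -, -⟩ := cell_sizes (L := L)
  have hd : (finrank ℝ (GnoFol L) : ℝ) ≤ 18 * (L : ℝ) ^ 4 := by rw [finrank_gnoFol_real (L := L)]; linarith
  have hL4 : 1 ≤ (L : ℝ) ^ 4 := one_le_pow₀ hL1
  set x : ℝ := (1 + (finrank ℝ (GnoFol L) : ℝ)) * (20400 * (L : ℝ) ^ 4) with hx
  have hx1 : 1 ≤ x := by
    rw [hx]
    have h0 : (0 : ℝ) ≤ (finrank ℝ (GnoFol L) : ℝ) := Nat.cast_nonneg _
    nlinarith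
  have hxle : x ≤ 19 * 20400 * (L : ℝ) ^ 8 := by
    rw [hx]
    have : 1 + (finrank ℝ (GnoFol L) : ℝ) ≤ 19 * (L : ℝ) ^ 4 := by linarith
    calc (1 + (finrank ℝ (GnoFol L) : ℝ)) * (20400 * (L : ℝ) ^ 4) ≤ 19 * (L : ℝ) ^ 4 * (20400 * (L : ℝ) ^ 4) := by gcongr
      _ = 19 * 20400 * (L : ℝ) ^ 8 := by ring
  calc x ^ (7 / 2 : ℝ) ≤ x ^ (4 : ℝ) := Real.rpow_le_rpow_of_exponent_le hx1 (by norm_num)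
    _ = x ^ 4 := by rw [show (4 : ℝ) = ((4 : ℕ) : ℝ) by norm_num, Real.rpow_natCast]
    _ ≤ (19 * 20400 * (L : ℝ) ^ 8) ^ 4 := pow_le_pow_left₀ (by linarith) hxle 4
    _ = (19 * 20400) ^ 4 * (L : ℝ) ^ 32 := by ring

omit [NeZero L] in
/-- Three tails into one: `Σᵢ e^{Cᵢ·L^{pᵢ} − b/(Qᵢ·L^{pᵢ})} ≤ e^{(C+2)·L^p − b/(Q·L^p)}` for `Cᵢ ≤ C`, `pᵢ ≤ p`, `Qᵢ ≤ Q` (`0 ≤ C`, `0 < Qᵢ`, `0 ≤ b`, `1 ≤ L`). [folklore] -/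
theorem three_tails_le {L' b C Q : ℝ} {p : ℕ} (hL : 1 ≤ L') (hb : 0 ≤ b) (hC : 0 ≤ C) {C₁ C₂ C₃ Q₁ Q₂ Q₃ : ℝ} {p₁ p₂ p₃ : ℕ}
    (hC₁ : C₁ ≤ C) (hC₂ : C₂ ≤ C) (hC₃ : C₃ ≤ C) (hQ₁ : 0 < Q₁) (hQ₂ : 0 < Q₂) (hQ₃ : 0 < Q₃) (hQ₁' : Q₁ ≤ Q) (hQ₂' : Q₂ ≤ Q) (hQ₃' : Q₃ ≤ Q)
    (hp₁ : p₁ ≤ p) (hp₂ : p₂ ≤ p) (hp₃ : p₃ ≤ p) :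
    Real.exp (C₁ * L' ^ p₁ - b / (Q₁ * L' ^ p₁)) + Real.exp (C₂ * L' ^ p₂ - b / (Q₂ * L' ^ p₂)) + Real.exp (C₃ * L' ^ p₃ - b / (Q₃ * L' ^ p₃)) ≤
      Real.exp ((C + 2) * L' ^ p - b / (Q * L' ^ p)) := by
  have hLp : ∀ {q : ℕ}, q ≤ p → L' ^ q ≤ L' ^ p := fun hq => pow_le_pow_right₀ hL hq
  have hLq0 : ∀ q : ℕ, 0 < L' ^ q := fun q => pow_pos (by linarith) q
  have hone : ∀ {Ci Qi : ℝ} {pi : ℕ}, Ci ≤ C → 0 < Qi → Qi ≤ Q → pi ≤ p →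
      Real.exp (Ci * L' ^ pi - b / (Qi * L' ^ pi)) ≤ Real.exp (C * L' ^ p - b / (Q * L' ^ p)) := by
    intro Ci Qi pi hCi hQi hQi' hpi
    apply Real.exp_le_exp.2
    have h1 : Ci * L' ^ pi ≤ C * L' ^ p :=
      calc Ci * L' ^ pi ≤ C * L' ^ pi := mul_le_mul_of_nonneg_right hCi (hLq0 pi).le
        _ ≤ C * L' ^ p := mul_le_mul_of_nonneg_left (hLp hpi) hC
    have h2 : b / (Q * L' ^ p) ≤ b / (Qi * L' ^ pi) :=
      div_le_div_of_nonneg_left hb (mul_pos hQi (hLq0 pi)) (mul_le_mul hQi' (hLp hpi) (hLq0 pi).le (hQi.le.trans hQi'))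
    linarith
  have e1 := hone hC₁ hQ₁ hQ₁' hp₁
  have e2 := hone hC₂ hQ₂ hQ₂' hp₂
  have e3 := hone hC₃ hQ₃ hQ₃' hp₃
  have h3 : (3 : ℝ) ≤ Real.exp 2 := by
    have := Real.add_one_le_exp (2 : ℝ); linarith
  have hLp1 : 1 ≤ L' ^ p := one_le_pow₀ hL
  calc Real.exp (C₁ * L' ^ p₁ - b / (Q₁ * L' ^ p₁)) + Real.exp (C₂ * L' ^ p₂ - b / (Q₂ * L' ^ p₂)) + Real.exp (C₃ * L' ^ p₃ - b / (Q₃ * L' ^ p₃))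
      ≤ 3 * Real.exp (C * L' ^ p - b / (Q * L' ^ p)) := by linarith
    _ ≤ Real.exp 2 * Real.exp (C * L' ^ p - b / (Q * L' ^ p)) := by gcongr
    _ = Real.exp (2 + (C * L' ^ p - b / (Q * L' ^ p))) := by rw [Real.exp_add]
    _ ≤ Real.exp ((C + 2) * L' ^ p - b / (Q * L' ^ p)) := Real.exp_le_exp.2 (by nlinarith)

/-! ## §2 The shell currency under the `p`-integral -/

/-- ★ `∫⁻_p ofReal(Profile(δt,p)·((1+p₁²)⁻¹(1+p₂²)⁻¹/√det A₀(gnoBase p))) ≤ ofReal(e·(19·20400)⁴·L³²·∫_p Profile(δt,p)·𝔪(hubAt δs 1, ε, p))` for good `ε`, an apex family `A₀`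
(symmetric + ray + ambient identities at the hub `1`) and `δs ≥ 12·122689728·2304·36·L¹⁸` (apexRef window with `δr := δs`). [cite: Luscher1983, §2] -/
theorem lintegral_profile_apexRef_le {ε : GnoSign L} (hε : GoodSign ε) {δs : ℝ} (hδs : 12 * 122689728 * 2304 * 36 * (L : ℝ) ^ 18 ≤ δs) (δt : ℝ)
    {A0 : GnoCoord L → GnoFol L →ₗ[ℝ] GnoFol L} (hA0s : ∀ η, (A0 η).IsSymmetric)
    (hA0ray : ∀ η (y : GnoFol L), ⟪A0 η y, y⟫_ℝ = iteratedDeriv 2 (fun s : ℝ => gnoDeficit (fun _ => false) (fun _ => 1) ((1 : ℝ) : ℍ) ε (η + s • gnoFolEmb y)) 0)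
    (hA0amb : ∀ η (y : GnoFol L), ⟪A0 η y, y⟫_ℝ = iteratedFDeriv ℝ 2 (gnoDeficit z₀ (fun _ => 1) ((1 : ℝ) : ℍ) ε) η (fun _ => gnoFolEmb y)) :
    ∫⁻ p : ℝ × ℝ, ENNReal.ofReal ((1 + δt ^ 2) ^ 2 / (1 + (p.1 ^ 2 / (1 + p.1 ^ 2) + p.2 ^ 2 / (1 + p.2 ^ 2)) * (1 + δt ^ 2)) *
        ((1 + p.1 ^ 2)⁻¹ * (1 + p.2 ^ 2)⁻¹ / Real.sqrt (LinearMap.det (A0 (gnoBase p.1 p.2))))) ≤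
      ENNReal.ofReal (Real.exp 1 * ((19 * 20400) ^ 4 * (L : ℝ) ^ 32) *
        ∫ p : ℝ × ℝ, (1 + δt ^ 2) ^ 2 / (1 + (p.1 ^ 2 / (1 + p.1 ^ 2) + p.2 ^ 2 / (1 + p.2 ^ 2)) * (1 + δt ^ 2)) * mbDensity (L := L) (hubAt δs 1) ε p) := by
  obtain ⟨hL1, hc1, hc6, hμ0, -⟩ := cell_sizes (L := L)
  have hL0 : (0 : ℝ) < L := by linarith
  set n : ℝ := (Fintype.card (Fol L) : ℝ) with hn
  set μ : ℝ := (2304 * (L : ℝ) ^ 6 * n)⁻¹ with hμ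
  -- the apexRef window with `δr := δs`
  have hδs1 : 1 ≤ δs := by
    have : (1 : ℝ) ≤ 12 * 122689728 * 2304 * 36 * (L : ℝ) ^ 18 := by
      have := one_le_pow₀ (n := 18) hL1; nlinarith
    linarith
  have hδs0 : 0 < δs := by linarith
  have hwin : 122689728 * δs⁻¹ * (L : ℝ) ^ 4 ≤ μ / (2 * (3 * n)) := by
    -- `122689728 L⁴/δs ≤ μ/(6n)` ⟸ `δs ≥ 122689728·6n·L⁴/μ = 122689728·6·2304·L¹⁰·n²` and `n ≤ 6L⁴`
    have hμeq : μ / (2 * (3 * n)) = 1 / (2304 * (L : ℝ) ^ 6 * n * (6 * n)) := by rw [hμ]; field_simp; ring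
    rw [hμeq, show 122689728 * δs⁻¹ * (L : ℝ) ^ 4 = (122689728 * (L : ℝ) ^ 4) / δs by ring, div_le_div_iff₀ hδs0 (by positivity)]
    have hn2 : n * n ≤ 36 * (L : ℝ) ^ 8 := by nlinarith
    have e : 122689728 * (L : ℝ) ^ 4 * (2304 * (L : ℝ) ^ 6 * n * (6 * n)) = 6 * 122689728 * 2304 * (L : ℝ) ^ 10 * (n * n) := by ring
    rw [e, one_mul]
    calc 6 * 122689728 * 2304 * (L : ℝ) ^ 10 * (n * n) ≤ 6 * 122689728 * 2304 * (L : ℝ) ^ 10 * (36 * (L : ℝ) ^ 8) := by gcongr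
      _ = 6 * 122689728 * 2304 * 36 * (L : ℝ) ^ 18 := by ring
      _ ≤ 12 * 122689728 * 2304 * 36 * (L : ℝ) ^ 18 := by nlinarith [pow_nonneg hL0.le 18]
      _ ≤ δs := hδs
  -- the pointwise apexRef inequality, rearranged
  set K : ℝ := ((1 + (finrank ℝ (GnoFol L) : ℝ)) * (20400 * (L : ℝ) ^ 4)) ^ (-(7 / 2 : ℝ)) with hK
  have hK0 : 0 < K := by rw [hK]; exact Real.rpow_pos_of_pos (by positivity) _
  have hKinv : K⁻¹ ≤ (19 * 20400) ^ 4 * (L : ℝ) ^ 32 := by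
    rw [hK, Real.rpow_neg (by positivity), inv_inv]
    exact apexConst_inv_le (L := L)
  set Pr : ℝ × ℝ → ℝ := fun p => (1 + δt ^ 2) ^ 2 / (1 + (p.1 ^ 2 / (1 + p.1 ^ 2) + p.2 ^ 2 / (1 + p.2 ^ 2)) * (1 + δt ^ 2)) with hPr
  have hPr0 : ∀ p, 0 ≤ Pr p := fun p => by rw [hPr]; positivity
  have hPrle : ∀ p, Pr p ≤ (1 + δt ^ 2) ^ 2 := fun p => by
    rw [hPr]
    apply div_le_self (by positivity)
    have : 0 ≤ (p.1 ^ 2 / (1 + p.1 ^ 2) + p.2 ^ 2 / (1 + p.2 ^ 2)) * (1 + δt ^ 2) := by positivity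
    linarith
  have hpt : ∀ p : ℝ × ℝ, Pr p * ((1 + p.1 ^ 2)⁻¹ * (1 + p.2 ^ 2)⁻¹ / Real.sqrt (LinearMap.det (A0 (gnoBase p.1 p.2)))) ≤
      Real.exp 1 * ((19 * 20400) ^ 4 * (L : ℝ) ^ 32) * (Pr p * mbDensity (L := L) (hubAt δs 1) ε p) := by
    intro p
    have h := apexRef_le_mbDensity_hubAt (L := L) hε hδs1 le_rfl hwin hA0s hA0ray hA0amb p
    -- `w₀·(K·e^{-1/2}/√det) ≤ e^{1/2}·𝔪` ⟹ `w₀/√det ≤ e·K⁻¹·𝔪`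
    have hsq : 0 ≤ (Real.sqrt (LinearMap.det (A0 (gnoBase p.1 p.2))))⁻¹ := inv_nonneg.2 (Real.sqrt_nonneg _)
    have hw0 : 0 ≤ (1 + p.1 ^ 2)⁻¹ * (1 + p.2 ^ 2)⁻¹ := by positivity
    have hm0 : 0 ≤ mbDensity (L := L) (hubAt δs 1) ε p := mbDensity_nonneg _ ε p
    have key : (1 + p.1 ^ 2)⁻¹ * (1 + p.2 ^ 2)⁻¹ / Real.sqrt (LinearMap.det (A0 (gnoBase p.1 p.2))) ≤
        Real.exp 1 * K⁻¹ * mbDensity (L := L) (hubAt δs 1) ε p := by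
      have e1 : (1 + p.1 ^ 2)⁻¹ * (1 + p.2 ^ 2)⁻¹ / Real.sqrt (LinearMap.det (A0 (gnoBase p.1 p.2))) =
          (K * Real.exp (-(1 / 2 : ℝ)))⁻¹ * ((1 + p.1 ^ 2)⁻¹ * (1 + p.2 ^ 2)⁻¹ *
            (K * Real.exp (-(1 / 2 : ℝ)) / Real.sqrt (LinearMap.det (A0 (gnoBase p.1 p.2))))) := by
        have hKe : K * Real.exp (-(1 / 2 : ℝ)) ≠ 0 := mul_ne_zero hK0.ne' (Real.exp_pos _).ne'
        field_simp
      rw [e1]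
      have e2 : Real.exp 1 * K⁻¹ * mbDensity (L := L) (hubAt δs 1) ε p = (K * Real.exp (-(1 / 2 : ℝ)))⁻¹ * (Real.exp (1 / 2) * mbDensity (L := L) (hubAt δs 1) ε p) := by
        rw [mul_inv, Real.exp_neg, inv_inv]
        have : Real.exp 1 = Real.exp (1 / 2) * Real.exp (1 / 2) := by rw [← Real.exp_add]; norm_num
        rw [this]; ring
      rw [e2]
      exact mul_le_mul_of_nonneg_left h (inv_nonneg.2 (mul_nonneg hK0.le (Real.exp_pos _).le))
    calc Pr p * ((1 + p.1 ^ 2)⁻¹ * (1 + p.2 ^ 2)⁻¹ / Real.sqrt (LinearMap.det (A0 (gnoBase p.1 p.2))))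
        ≤ Pr p * (Real.exp 1 * K⁻¹ * mbDensity (L := L) (hubAt δs 1) ε p) := mul_le_mul_of_nonneg_left key (hPr0 p)
      _ ≤ Pr p * (Real.exp 1 * ((19 * 20400) ^ 4 * (L : ℝ) ^ 32) * mbDensity (L := L) (hubAt δs 1) ε p) := by
          apply mul_le_mul_of_nonneg_left _ (hPr0 p)
          apply mul_le_mul_of_nonneg_right _ hm0
          exact mul_le_mul_of_nonneg_left hKinv (Real.exp_pos 1).le
      _ = Real.exp 1 * ((19 * 20400) ^ 4 * (L : ℝ) ^ 32) * (Pr p * mbDensity (L := L) (hubAt δs 1) ε p) := by ring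
  -- integrability of `Profile·𝔪` at the shell hub
  have hint : Integrable fun p : ℝ × ℝ => Pr p * mbDensity (L := L) (hubAt δs 1) ε p := by
    set τ : ℝ := min (4 * δs ^ 2 / (1 + δs ^ 2) ^ 2) (1 + δs ^ 2)⁻¹ with hτ
    have hτ0 : 0 < τ := lt_min (by positivity) (by positivity)
    have hτ1 : τ ≤ 1 := (min_le_right _ _).trans (inv_le_one_of_one_le₀ (by nlinarith))
    have hm := integrable_mbDensity_hubAt_of_window (L := L) hε hτ0 hτ1 (δ := δs) ⟨min_le_left _ _, min_le_right _ _⟩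
    have hPm : Measurable Pr := by rw [hPr]; fun_prop
    refine (hm.const_mul ((1 + δt ^ 2) ^ 2)).mono' (hPm.aestronglyMeasurable.mul hm.aestronglyMeasurable) (Filter.Eventually.of_forall fun p => ?_)
    rw [Real.norm_eq_abs, abs_of_nonneg (mul_nonneg (hPr0 p) (mbDensity_nonneg _ ε p))]
    exact mul_le_mul_of_nonneg_right (hPrle p) (mbDensity_nonneg _ ε p)
  have hint' := hint.const_mul (Real.exp 1 * ((19 * 20400) ^ 4 * (L : ℝ) ^ 32))
  -- conclude
  calc ∫⁻ p : ℝ × ℝ, ENNReal.ofReal (Pr p * ((1 + p.1 ^ 2)⁻¹ * (1 + p.2 ^ 2)⁻¹ / Real.sqrt (LinearMap.det (A0 (gnoBase p.1 p.2)))))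
      ≤ ∫⁻ p : ℝ × ℝ, ENNReal.ofReal (Real.exp 1 * ((19 * 20400) ^ 4 * (L : ℝ) ^ 32) * (Pr p * mbDensity (L := L) (hubAt δs 1) ε p)) :=
        lintegral_mono fun p => ENNReal.ofReal_le_ofReal (hpt p)
    _ = ENNReal.ofReal (∫ p : ℝ × ℝ, Real.exp 1 * ((19 * 20400) ^ 4 * (L : ℝ) ^ 32) * (Pr p * mbDensity (L := L) (hubAt δs 1) ε p)) := by
        rw [ofReal_integral_eq_lintegral_ofReal hint' (Filter.Eventually.of_forall fun p =>
          mul_nonneg (by positivity) (mul_nonneg (hPr0 p) (mbDensity_nonneg _ ε p)))]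
    _ = _ := by rw [integral_const_mul]










/-! ## §3 ENNReal bookkeeping -/

/-- Socket + shell currency in one real number: `X ≤ ofReal(A)·I + ofReal(e^t)` and `I ≤ ofReal(EJ)` give `X ≤ ofReal(A·EJ + e^t)`. [folklore] -/
theorem socket_to_ofReal {X I : ℝ≥0∞} {A EJ t : ℝ} (hA : 0 ≤ A) (hEJ : 0 ≤ EJ)
    (hR : X ≤ ENNReal.ofReal A * I + ENNReal.ofReal (Real.exp t)) (hI : I ≤ ENNReal.ofReal EJ) :
    X ≤ ENNReal.ofReal (A * EJ + Real.exp t) := by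
  calc X ≤ ENNReal.ofReal A * I + ENNReal.ofReal (Real.exp t) := hR
    _ ≤ ENNReal.ofReal A * ENNReal.ofReal EJ + ENNReal.ofReal (Real.exp t) := by gcongr
    _ = ENNReal.ofReal (A * EJ + Real.exp t) := by
        rw [← ENNReal.ofReal_mul hA, ← ENNReal.ofReal_add (mul_nonneg hA hEJ) (Real.exp_pos t).le]

/-- A three-set cover splits a `lintegral`: `∫⁻ f ≤ ∫⁻_{S₁} f + ∫⁻_{S₂} f + ∫⁻_{S₃} f` (no measurability needed). [folklore] -/
theorem lintegral_le_of_cover3 (f : GnoCoord L → ℝ≥0∞) {S₁ S₂ S₃ : Set (GnoCoord L)} (h : ∀ η, η ∈ S₁ ∪ S₂ ∪ S₃) :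
    ∫⁻ η, f η ≤ (∫⁻ η in S₁, f η) + (∫⁻ η in S₂, f η) + ∫⁻ η in S₃, f η := by
  have hu : (Set.univ : Set (GnoCoord L)) ⊆ S₁ ∪ S₂ ∪ S₃ := fun η _ => h η
  calc ∫⁻ η, f η = ∫⁻ η in Set.univ, f η := by rw [Measure.restrict_univ]
    _ ≤ ∫⁻ η in S₁ ∪ S₂ ∪ S₃, f η := lintegral_mono_set hu
    _ ≤ (∫⁻ η in S₁ ∪ S₂, f η) + ∫⁻ η in S₃, f η := lintegral_union_le _ _ _
    _ ≤ _ := by gcongr; exact lintegral_union_le _ _ _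

/-! ## §4 w2's concrete regions ORIG ∕ PX ∕ PY cover the fibre -/

omit [NeZero L] in
/-- The three regions of the aligned-rotation assembly cover everything: with `s² = (1+δt²)⁻¹`, every `η` has `|x|²,|y|² ≤ s²` (ORIG), or `|y|² ≤ |x|²` and
`s² < |x|²` (PX), or `|x|² < |y|²` and `s² < |y|²` (PY). [folklore] -/
theorem tipRegions_cover (δt : ℝ) (η : GnoCoord L) :
    η ∈ {η : GnoCoord L | Gnomonic.normSq3 η.1.1 ≤ (1 + δt ^ 2)⁻¹ ∧ Gnomonic.normSq3 η.1.2 ≤ (1 + δt ^ 2)⁻¹} ∪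
        {η : GnoCoord L | Gnomonic.normSq3 η.1.2 ≤ Gnomonic.normSq3 η.1.1 ∧ (1 + δt ^ 2)⁻¹ < Gnomonic.normSq3 η.1.1} ∪
        {η : GnoCoord L | Gnomonic.normSq3 η.1.1 < Gnomonic.normSq3 η.1.2 ∧ (1 + δt ^ 2)⁻¹ < Gnomonic.normSq3 η.1.2} := by
  simp only [Set.mem_union, Set.mem_setOf_eq]
  by_cases hx : Gnomonic.normSq3 η.1.1 ≤ (1 + δt ^ 2)⁻¹
  · by_cases hy : Gnomonic.normSq3 η.1.2 ≤ (1 + δt ^ 2)⁻¹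
    · exact Or.inl (Or.inl ⟨hx, hy⟩)
    · right; exact ⟨lt_of_le_of_lt hx (not_le.1 hy), not_le.1 hy⟩
  · rcases le_or_gt (Gnomonic.normSq3 η.1.2) (Gnomonic.normSq3 η.1.1) with h | h
    · exact Or.inl (Or.inr ⟨h, not_le.1 hx⟩)
    · right; exact ⟨h, (not_le.1 hx).trans h⟩


/-! ## §5 Raw-shape adapters for the region provers (Profile from the PX box and the ORIG disc) -/

omit [NeZero L] in
/-- PX ∕ PY adapter: on `{(1+δt²)⁻¹ < a², b² ≤ a²}` the aligned main-term weight is Profile-bounded,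
`(1+δt²)·(1+a²)/a² ≤ 4·Profile(δt,(a,b))` (since `h(a,b) ≤ 2h₁(a)` and `h₁(a)(1+δt²) ≥ ½`). [folklore] -/
theorem profile_ge_of_PX {δt a b : ℝ} (ha : (1 + δt ^ 2)⁻¹ < a ^ 2) (hb : b ^ 2 ≤ a ^ 2) :
    (1 + δt ^ 2) * (1 + a ^ 2) / a ^ 2 ≤ 4 * ((1 + δt ^ 2) ^ 2 / (1 + (a ^ 2 / (1 + a ^ 2) + b ^ 2 / (1 + b ^ 2)) * (1 + δt ^ 2))) := by
  set T : ℝ := 1 + δt ^ 2 with hT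
  have hT1 : 1 ≤ T := by rw [hT]; nlinarith [sq_nonneg δt]
  have hT0 : 0 < T := by linarith
  have ha0 : 0 < a ^ 2 := lt_trans (inv_pos.2 hT0) ha
  have haT : 1 < a ^ 2 * T := by
    have := (inv_lt_iff_one_lt_mul₀ hT0).1 ha
    linarith [this]
  -- `h₂ ≤ h₁`
  have hmono : b ^ 2 / (1 + b ^ 2) ≤ a ^ 2 / (1 + a ^ 2) := by
    rw [div_le_div_iff₀ (by positivity) (by positivity)]; nlinarith [sq_nonneg b]
  -- `h₁ T ≥ 1/2`
  have hkey : 1 / 2 ≤ a ^ 2 / (1 + a ^ 2) * T := by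
    rcases le_or_gt (a ^ 2) 1 with h1 | h1
    · rw [div_mul_eq_mul_div, le_div_iff₀ (by positivity)]; nlinarith
    · rw [div_mul_eq_mul_div, le_div_iff₀ (by positivity)]; nlinarith
  have hden : 0 < 1 + (a ^ 2 / (1 + a ^ 2) + b ^ 2 / (1 + b ^ 2)) * T := by positivity
  have hh1 : 0 < a ^ 2 / (1 + a ^ 2) := by positivity
  have hh : (a ^ 2 / (1 + a ^ 2) + b ^ 2 / (1 + b ^ 2)) ≤ 2 * (a ^ 2 / (1 + a ^ 2)) := by linarith
  have eL : T * (1 + a ^ 2) / a ^ 2 = T / (a ^ 2 / (1 + a ^ 2)) := by field_simp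
  rw [eL, ← mul_div_assoc, div_le_div_iff₀ hh1 hden]
  -- `T·(1 + (h₁+h₂)T) ≤ 4T²·h₁` from `1 ≤ 2h₁T` and `h₁ + h₂ ≤ 2h₁`
  have h3 : (a ^ 2 / (1 + a ^ 2) + b ^ 2 / (1 + b ^ 2)) * T ≤ 2 * (a ^ 2 / (1 + a ^ 2)) * T := mul_le_mul_of_nonneg_right hh hT0.le
  nlinarith [h3, hkey, hT0]

omit [NeZero L] in
/-- ORIG adapter: on the disc `a² + b² ≤ 2(1+δt²)⁻¹` the Profile is at its corner value, `(1+δt²)² ≤ 3·Profile(δt,(a,b))`. [folklore] -/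
theorem profile_ge_of_ORIG {δt a b : ℝ} (hab : a ^ 2 + b ^ 2 ≤ 2 * (1 + δt ^ 2)⁻¹) :
    (1 + δt ^ 2) ^ 2 ≤ 3 * ((1 + δt ^ 2) ^ 2 / (1 + (a ^ 2 / (1 + a ^ 2) + b ^ 2 / (1 + b ^ 2)) * (1 + δt ^ 2))) := by
  set T : ℝ := 1 + δt ^ 2 with hT
  have hT0 : 0 < T := by rw [hT]; positivity
  have h1 : a ^ 2 / (1 + a ^ 2) ≤ a ^ 2 := div_le_self (sq_nonneg a) (by nlinarith [sq_nonneg a])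
  have h2 : b ^ 2 / (1 + b ^ 2) ≤ b ^ 2 := div_le_self (sq_nonneg b) (by nlinarith [sq_nonneg b])
  have hhT : (a ^ 2 / (1 + a ^ 2) + b ^ 2 / (1 + b ^ 2)) * T ≤ 2 := by
    have : (a ^ 2 + b ^ 2) * T ≤ 2 := by
      have := mul_le_mul_of_nonneg_right hab hT0.le
      rwa [mul_assoc, inv_mul_cancel₀ hT0.ne', mul_one] at this
    nlinarith [mul_le_mul_of_nonneg_right (add_le_add h1 h2) hT0.le]
  have hden : 0 < 1 + (a ^ 2 / (1 + a ^ 2) + b ^ 2 / (1 + b ^ 2)) * T := by positivity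
  rw [mul_div_assoc', le_div_iff₀ hden]
  nlinarith [sq_nonneg T]

omit [NeZero L] in
/-- ORIG adapter for the base weight: on `a² + b² ≤ 2`, `1 ≤ 9·(1+a²)⁻¹(1+b²)⁻¹`. [folklore] -/
theorem baseWeight_ge_ninth_of_ORIG {a b : ℝ} (hab : a ^ 2 + b ^ 2 ≤ 2) : 1 ≤ 9 * ((1 + a ^ 2)⁻¹ * (1 + b ^ 2)⁻¹) := by
  have h : (1 + a ^ 2) * (1 + b ^ 2) ≤ 9 := by nlinarith [sq_nonneg a, sq_nonneg b, mul_nonneg (sq_nonneg a) (sq_nonneg b)]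
  rw [← mul_inv, ← div_eq_mul_inv, le_div_iff₀ (by positivity)]
  linarith

end Summit.QuantumFields.YangMills.Theorems.SwapVirialDeficit.SectorLaplace

end
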